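import Literature.AlgebraicGeometry.Resolution.WeightedBlowupMonomialStall

/-!
# At a coordinate point the stall is decided term by term: Proposition S′ is an equivalence (pub-rosobs observatory)

`WeightedBlowupMonomialStall` proves that the monomialwise hypothesis `hS` at the coordinate point `e_j`
IMPLIES a stall of the second entry.  Here we prove the CONVERSE over a domain, so that at coordinate
points the stall locus of `(q, ord₀ F_clean)` under the transplanted weighted step is decided monomial by
monomial (`secondEntryStalls_iff_monomialwise`).

The reason is a rigidity of the cobordant chart (derived here, elementary): the Taylor exponent
`taylorExponent w ℓ j β k = (n_β ; β with β_j ↦ k)` DETERMINES `(β, k)` — the entries off `u'_j` give `β`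
off `j`, and the `s`-exponent `n_β = Σ wᵢβᵢ − ℓ` then gives `β_j` because `w_j > 0`
(`taylorExponent_injective`).  Hence distinct monomials of `F` never contribute to the same monomial of
`F'(s, u' + e_j)`: NO CANCELLATION is possible at a coordinate point, the coefficient of
`u'^{taylorExponent β k}` is the single term `c_β · C(β_j, k)` (`coeff_pointPolynomial_taylorExponent`), and
a stall forces every such term of degree `< ord₀ F` that is not a `q`-th power to vanish.  (The
observatory's census agrees: in all five family tables every stall at a coordinate point satisfies S′;
cancellation stalls occur only at points with ≥ 2 translated coordinates — pub-rosobs AGREE-g4 §6.)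
Published ingredients as in `WeightedBlowupNoIncrease` [AbramovichQuekSchober2025, Def. 4.5;
AbramovichTemkinWlodarczyk2024, §5.1; Hauser2010, §G]. [folklore]
-/

open MvPolynomial Finset

open scoped BigOperators

namespace Literature.AlgebraicGeometry.Resolution

open Literature.AlgebraicGeometry.Resolution.Hauser2010

noncomputable section

namespace WeightedBlowup

variable {σ : Type*} {K : Type*} [CommRing K] [Fintype σ] [DecidableEq σ]

omit [DecidableEq σ] in
/-- The weighted degree of an admissible monomial is at least `ℓ` (so the `s`-exponent `n_β = Σ wᵢβᵢ − ℓ`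
involves no truncation). [folklore] -/
theorem le_weightedDegree_of_admissible (γ : σ → ℚ) (w : σ → ℕ) (ℓ : ℕ) (β : σ →₀ ℕ)
    (hadm : 1 ≤ monomialValuation γ β) (hw : ∀ i, (w i : ℚ) = ℓ * γ i) : ℓ ≤ ∑ i, w i * β i := by
  have hval : monomialValuation γ β = ∑ i, (β i : ℚ) * γ i := by
    unfold monomialValuation
    rw [Finsupp.sum_fintype _ _ (fun i => by simp)]
  have h : ((∑ i, w i * β i : ℕ) : ℚ) = ℓ * monomialValuation γ β := by
    rw [hval]
    push_cast
    rw [Finset.mul_sum]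
    refine Finset.sum_congr rfl fun i _ => ?_
    rw [hw i]; ring
  have hℓ : (ℓ : ℚ) ≤ ((∑ i, w i * β i : ℕ) : ℚ) := by
    rw [h]
    have : (0 : ℚ) ≤ ℓ := by positivity
    nlinarith
  exact_mod_cast hℓ

omit [DecidableEq σ] in
/-- **Rigidity of the cobordant chart at a coordinate point.** The Taylor exponent determines the pair
`(β, k)`: for admissible `β, β'` (weighted degree `≥ ℓ`) and `w_j ≠ 0`,
`taylorExponent β k = taylorExponent β' k' → β = β' ∧ k = k'`. (derived here) [folklore] -/
theorem taylorExponent_injective (w : σ → ℕ) (ℓ : ℕ) (j : σ) (hwj : w j ≠ 0)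
    {β β' : σ →₀ ℕ} {k k' : ℕ} (hβ : ℓ ≤ ∑ i, w i * β i) (hβ' : ℓ ≤ ∑ i, w i * β' i)
    (h : taylorExponent w ℓ j β k = taylorExponent w ℓ j β' k') : β = β' ∧ k = k' := by
  classical
  have hk : k = k' := by
    have := DFunLike.congr_fun h (some j)
    rwa [taylorExponent_some_self, taylorExponent_some_self] at this
  have hoff : ∀ i, i ≠ j → β i = β' i := by
    intro i hi
    have hne : (some i : Option σ) ≠ some j := fun e => hi (Option.some_injective σ e)
    have := DFunLike.congr_fun h (some i)
    rwa [taylorExponent_of_ne w ℓ j β k hne, taylorExponent_of_ne w ℓ j β' k' hne,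
      cobordantExponent_some, cobordantExponent_some] at this
  have hnone : (∑ i, w i * β i) - ℓ = (∑ i, w i * β' i) - ℓ := by
    have hne : (none : Option σ) ≠ some j := by simp
    have := DFunLike.congr_fun h none
    rwa [taylorExponent_of_ne w ℓ j β k hne, taylorExponent_of_ne w ℓ j β' k' hne,
      cobordantExponent_none, cobordantExponent_none] at this
  have hsum : ∑ i, w i * β i = ∑ i, w i * β' i := by omega
  have hsplit : ∀ δ : σ →₀ ℕ, ∑ i, w i * δ i = w j * δ j + ∑ i ∈ Finset.univ.erase j, w i * δ i :=
    fun δ => (Finset.add_sum_erase Finset.univ (fun i => w i * δ i) (Finset.mem_univ j)).symm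
  have hrest : ∑ i ∈ Finset.univ.erase j, w i * β i = ∑ i ∈ Finset.univ.erase j, w i * β' i :=
    Finset.sum_congr rfl fun i hi => by rw [hoff i (Finset.ne_of_mem_erase hi)]
  rw [hsplit β, hsplit β', hrest] at hsum
  have hj : β j = β' j := Nat.eq_of_mul_eq_mul_left (Nat.pos_of_ne_zero hwj) (by omega)
  refine ⟨Finsupp.ext fun i => ?_, hk⟩
  by_cases hi : i = j
  · rw [hi, hj]
  · exact hoff i hi

/-- **No cancellation at a coordinate point.** At the coordinate point `e_j` (`b (some j) = 1`, `b = 0`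
elsewhere) the coefficient of `u'^{taylorExponent β k}` in `F'(s, u' + e_j)` is the single Taylor term
`coeff β F · C(β_j, k)`. (derived here) [folklore] -/
theorem coeff_pointPolynomial_taylorExponent (γ : σ → ℚ) (w : σ → ℕ) (ℓ : ℕ) (b : Option σ → K)
    (F : MvPolynomial σ K) (j : σ) (hadm : IsAdmissibleFor γ F)
    (hw : ∀ i, (w i : ℚ) = ℓ * γ i) (hℓ : 0 < ℓ) (hj : γ j ≠ 0)
    (hbj : b (some j) = 1) (hb : ∀ o, o ≠ some j → b o = 0)
    (β : σ →₀ ℕ) (hβ : β ∈ F.support) (k : ℕ) :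
    coeff (taylorExponent w ℓ j β k) (pointPolynomial w ℓ b F) = coeff β F * (((β j).choose k : ℕ) : K) := by
  classical
  have hwj : w j ≠ 0 := by
    intro h0
    have := hw j
    rw [h0] at this
    push_cast at this
    have hℓ' : (ℓ : ℚ) ≠ 0 := by exact_mod_cast hℓ.ne'
    exact hj (by
      rcases mul_eq_zero.mp this.symm with h | h
      · exact absurd h hℓ'
      · exact h)
  set D := taylorExponent w ℓ j β k with hD
  unfold pointPolynomial cobordantTransform
  unfold PointBlowup.translate
  rw [map_sum, coeff_sum]
  change ∑ x ∈ F.support, coeff D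
      (PointBlowup.translate b (monomial (cobordantExponent w ℓ x) (coeff x F))) = _
  rw [Finset.sum_eq_single β]
  · -- the term of β itself
    rw [coeff_translate_monomial]
    congr 1
    rw [Finset.prod_eq_single (some j)]
    · rw [cobordantExponent_some, hD, taylorExponent_some_self, hbj, one_pow, mul_one]
    · intro o _ ho
      rw [hD, taylorExponent_of_ne w ℓ j β k ho, Nat.choose_self, Nat.sub_self, pow_zero, mul_one,
        Nat.cast_one]
    · intro h; exact absurd (Finset.mem_univ _) h
  · -- every other monomial contributes nothing: its only candidate term would have the same exponent
    intro β' hβ' hne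
    set E' := cobordantExponent w ℓ β' with hE'
    by_cases h1 : ∃ o, E' o < D o
    · obtain ⟨o, ho⟩ := h1
      exact coeff_translate_monomial_eq_zero_of_lt b E' D _ ho
    by_cases h2 : ∃ o, o ≠ some j ∧ D o < E' o
    · obtain ⟨o, hoj, ho⟩ := h2
      exact coeff_translate_monomial_eq_zero_of_apply_eq_zero b E' D _ (hb o hoj) ho
    push Not at h1 h2
    exfalso
    have hDT : D = taylorExponent w ℓ j β' (D (some j)) := by
      ext o
      by_cases ho : o = some j
      · rw [ho]
        simp only [hD, taylorExponent_some_self]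
      · rw [taylorExponent_of_ne w ℓ j β' _ ho]
        exact le_antisymm (h1 o) (h2 o ho)
    have hinj := taylorExponent_injective w ℓ j hwj
      (le_weightedDegree_of_admissible γ w ℓ β (hadm β hβ) hw)
      (le_weightedDegree_of_admissible γ w ℓ β' (hadm β' hβ') hw) (hD.symm.trans hDT)
    exact hne hinj.1.symm
  · intro h; exact absurd hβ h

/-- **Proposition S′ is an equivalence at coordinate points (over a domain).** With the hypotheses of
`secondEntryStalls_of_monomialwise` and `b (some j) = 1`: the second entry stalls at `e_j` IF AND ONLY IF
every Taylor term of degree `< ord₀ F` with binomial coefficient non-zero in `K` has a `q`-th power exponent.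
(derived here) [folklore] -/
theorem secondEntryStalls_iff_monomialwise [IsDomain K] (q : ℕ) (γ : σ → ℚ) (w : σ → ℕ) (ℓ : ℕ)
    (b : Option σ → K) (F : MvPolynomial σ K) (n : ℕ) (j : σ)
    (hF : deletePthPowers q F = F) (hn : ordZero F = n)
    (hadm : IsAdmissibleFor γ F) (hγn : ∀ i, γ i * n ≤ 1)
    (hw : ∀ i, (w i : ℚ) = ℓ * γ i) (hℓ : 0 < ℓ)
    (hj : γ j ≠ 0) (hbj : b (some j) = 1) (hb : ∀ o, o ≠ some j → b o = 0) :
    SecondEntryStalls q w ℓ b F ↔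
      (∀ β ∈ F.support, ∀ k ≤ β j, (taylorExponent w ℓ j β k).degree < n →
        (((β j).choose k : ℕ) : K) ≠ 0 → IsPthPowerExponent q (taylorExponent w ℓ j β k)) := by
  classical
  refine ⟨fun hstall => ?_,
    secondEntryStalls_of_monomialwise q γ w ℓ b F n j hF hn hadm hγn hw hℓ hj hb⟩
  intro β hβ k _ hdeg hchoose
  by_contra hnot
  set D := taylorExponent w ℓ j β k with hD
  have hD0 : D ≠ 0 := by
    rintro h0
    exact hnot (by rw [h0]; exact fun i hi => by simp at hi)
  -- the stalled order is n, so the coefficient of D (degree < n) in the new residual vanishes …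
  have hord : ordZero (newResidual q w ℓ b F) = n := by
    have := hstall
    unfold SecondEntryStalls at this
    rw [this, hF, hn]
  have hzero : coeff D (newResidual q w ℓ b F) = 0 := by
    have hlt : (D.degree : ℕ∞) < (newResidual q w ℓ b F : MvPowerSeries (Option σ) K).order := by
      unfold ordZero at hord
      rw [hord]
      exact_mod_cast hdeg
    have := MvPowerSeries.coeff_of_lt_order hlt
    rwa [MvPolynomial.coeff_coe] at this
  -- … but it is the single non-zero Taylor term
  have hne : coeff D (newResidual q w ℓ b F) ≠ 0 := by
    unfold newResidual residual
    rw [coeff_deletePthPowers, if_neg hnot, coeff_sub, coeff_C, if_neg (Ne.symm hD0), sub_zero, hD,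
      coeff_pointPolynomial_taylorExponent γ w ℓ b F j hadm hw hℓ hj hbj hb β hβ k]
    exact mul_ne_zero (MvPolynomial.mem_support_iff.mp hβ) hchoose
  exact hne hzero

end WeightedBlowup

end

end Literature.AlgebraicGeometry.Resolution
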